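import Summits.KontsevichZagierPeriods.Zeta5Search.Certificates.PolyKronecker6
import Mathlib.Algebra.MvPolynomial.Funext
import Mathlib.Algebra.Polynomial.Roots

/-!
# Polynomial identity testing in the kernel — six variables, SLICED in the last variable (cell `pub-zeta5`, certifier `cert-2`)

HONEST FRAMING: systematic search; recurrence certificates; no irrationality claim unless certified.

`PolyKronecker6.peval_eq_zero_of_kron6` decides `peval e [a,b,c,d,u,t] = 0` by ONE evaluation; the size of that evaluation is
`∏ᵢ (degB i e + 1) · log₂ β` bits, which for the largest parametric (bmiss) certificates (direction `a` of fam-tele's Ω-induction)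
reaches several Gbit. This file trades the last variable for a GRID: if `degB 5 e ≤ D` and the `D+1` specialisations
`e[t := j]` (`substs (σT j) e`, `j = 0..D`, five-variable expressions) each vanish at THEIR Kronecker point, then `e` vanishes
identically (`peval_eq_zero_of_kron6_slices`). Proof: for integers `x₀..x₄` the univariate polynomial
`q = peval e [C x₀, …, C x₄, X] ∈ ℤ[X]` has `natDegree q ≤ degB 5 e ≤ D` (structural bound `natDegree_pevalX_le`) and the
`D+1` roots `0..D`, hence `q = 0`; so `toMv6 e` vanishes at every integer point, hence is `0` (`MvPolynomial.funext`).
General tooling; no named facts.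
-/

namespace Summit.KontsevichZagierPeriods.Zeta5Search.Certificates

namespace PolyReflect

open Lean.Grind.CommRing (Expr Var)
open MvPolynomial Finset Polynomial

/-- The substitution `v₅ := j` (an integer numeral), other variables unchanged. -/
def σT (j : ℤ) (k : ℕ) : Expr := if k = 5 then .num j else .var k

/-- Semantics of the `t`-specialisation: `peval (e[t := j]) [a₀,…,a₄,x] = peval e [a₀,…,a₄,j]` (any `x`). -/
theorem peval_substs_σT {R : Type*} [CommRing R] (e : Expr) (he : varsLT 6 e = true) (j : ℤ)
    (a₀ a₁ a₂ a₃ a₄ x : R) : peval (substs (σT j) e) [a₀, a₁, a₂, a₃, a₄, x] = peval e [a₀, a₁, a₂, a₃, a₄, (j : R)] := by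
  refine peval_substs (σT j) 6 [a₀, a₁, a₂, a₃, a₄, x] [a₀, a₁, a₂, a₃, a₄, (j : R)] (fun k hk => ?_) e he
  interval_cases k
  · rfl
  · rfl
  · rfl
  · rfl
  · rfl
  · show (j : R) = peval (Expr.num j) _
    rw [peval_num]

/-- The univariate shadow in `t`: `peval e [C x₀, …, C x₄, X] ∈ ℤ[X]` has `natDegree ≤ degB 5 e`. -/
theorem natDegree_pevalX_le (x₀ x₁ x₂ x₃ x₄ : ℤ) :
    ∀ e : Expr, varsLT 6 e = true →
      (peval e [Polynomial.C x₀, Polynomial.C x₁, Polynomial.C x₂, Polynomial.C x₃, Polynomial.C x₄, (Polynomial.X : ℤ[X])]).natDegree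
        ≤ degB 5 e
  | .num k, _ => by rw [peval_num, degB]; exact (natDegree_intCast _).le
  | .natCast k, _ => by rw [peval_natCast, degB]; exact (natDegree_natCast _).le
  | .intCast k, _ => by rw [peval_intCast, degB]; exact (natDegree_intCast _).le
  | .var i, hv => by
      simp only [varsLT, decide_eq_true_eq] at hv
      rw [peval_var, degB]
      interval_cases i
      · show (Polynomial.C x₀).natDegree ≤ _; simp
      · show (Polynomial.C x₁).natDegree ≤ _; simp
      · show (Polynomial.C x₂).natDegree ≤ _; simp
      · show (Polynomial.C x₃).natDegree ≤ _; simp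
      · show (Polynomial.C x₄).natDegree ≤ _; simp
      · show (Polynomial.X : ℤ[X]).natDegree ≤ _; simp
  | .neg a, hv => by
      simp only [varsLT] at hv
      rw [peval_neg, natDegree_neg, degB]; exact natDegree_pevalX_le x₀ x₁ x₂ x₃ x₄ a hv
  | .add a b, hv => by
      simp only [varsLT, Bool.and_eq_true] at hv
      rw [peval_add, degB]
      exact (natDegree_add_le _ _).trans (max_le_max (natDegree_pevalX_le _ _ _ _ _ a hv.1) (natDegree_pevalX_le _ _ _ _ _ b hv.2))
  | .sub a b, hv => by
      simp only [varsLT, Bool.and_eq_true] at hv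
      rw [peval_sub, degB]
      exact (natDegree_sub_le _ _).trans (max_le_max (natDegree_pevalX_le _ _ _ _ _ a hv.1) (natDegree_pevalX_le _ _ _ _ _ b hv.2))
  | .mul a b, hv => by
      simp only [varsLT, Bool.and_eq_true] at hv
      rw [peval_mul, degB]
      exact natDegree_mul_le.trans (Nat.add_le_add (natDegree_pevalX_le _ _ _ _ _ a hv.1) (natDegree_pevalX_le _ _ _ _ _ b hv.2))
  | .pow a k, hv => by
      simp only [varsLT] at hv
      rw [peval_pow, degB]
      exact natDegree_pow_le.trans (Nat.mul_le_mul_left k (natDegree_pevalX_le _ _ _ _ _ a hv))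

/-- Evaluating the univariate shadow at `j` gives `peval e [x₀,…,x₄,j]`. -/
theorem eval_pevalX (x₀ x₁ x₂ x₃ x₄ j : ℤ) (e : Expr) :
    (peval e [Polynomial.C x₀, Polynomial.C x₁, Polynomial.C x₂, Polynomial.C x₃, Polynomial.C x₄, (Polynomial.X : ℤ[X])]).eval j
      = peval e [x₀, x₁, x₂, x₃, x₄, j] := by
  have h := map_peval (Polynomial.evalRingHom j)
    [Polynomial.C x₀, Polynomial.C x₁, Polynomial.C x₂, Polynomial.C x₃, Polynomial.C x₄, (Polynomial.X : ℤ[X])] e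
  rw [Polynomial.coe_evalRingHom] at h
  rw [h]
  simp

/-- `toMv6 e` evaluated at an integer point is `peval e` there. -/
theorem eval_toMv6 (x : ℕ → ℤ) (e : Expr) :
    MvPolynomial.eval x (toMv6 e) = peval e [x 0, x 1, x 2, x 3, x 4, x 5] := by
  have h := map_peval (MvPolynomial.eval x) [X 0, X 1, X 2, X 3, X 4, X 5] e
  rw [toMv6, h]
  simp

/-- **Slice criterion**: if every `t`-specialisation `e[t := j]`, `j = 0..D` (`D ≥ degB 5 e`), vanishes at its Kronecker point,
then `toMv6 e = 0`. -/
theorem toMv6_eq_zero_of_slices (e : Expr) (hv : varsLT 6 e = true) (D : ℕ) (hD : degB 5 e ≤ D)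
    (hvs : ∀ j : ℕ, j ≤ D → varsLT 6 (substs (σT j) e) = true)
    (hs : ∀ j : ℕ, j ≤ D → peval (substs (σT j) e) (kronPoint6 (substs (σT j) e)) = 0) : toMv6 e = 0 := by
  apply MvPolynomial.funext
  intro x
  rw [map_zero, eval_toMv6]
  -- the univariate shadow q(T) = peval e [C x0, …, C x4, T]
  set q : ℤ[X] := peval e [Polynomial.C (x 0), Polynomial.C (x 1), Polynomial.C (x 2), Polynomial.C (x 3), Polynomial.C (x 4),
    (Polynomial.X : ℤ[X])] with hq
  have hroot : ∀ j : ℕ, j ≤ D → q.eval (j : ℤ) = 0 := by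
    intro j hj
    rw [hq, eval_pevalX]
    have h0 := peval_eq_zero_of_kron6 (substs (σT j) e) (hvs j hj) (hs j hj) (x 0) (x 1) (x 2) (x 3) (x 4) (0 : ℤ)
    rw [peval_substs_σT e hv] at h0
    exact_mod_cast h0
  have hqz : q = 0 := by
    by_contra hne
    have hdeg : q.natDegree ≤ D := (natDegree_pevalX_le _ _ _ _ _ e hv).trans hD
    -- D+1 distinct roots 0..D
    have hsub : (Finset.range (D + 1)).image (fun j : ℕ => (j : ℤ)) ⊆ q.roots.toFinset := by
      intro z hz
      obtain ⟨j, hj, rfl⟩ := Finset.mem_image.mp hz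
      rw [Multiset.mem_toFinset, Polynomial.mem_roots hne]
      exact hroot j (by simpa [Nat.lt_succ_iff] using hj)
    have hcard : D + 1 ≤ q.roots.toFinset.card := by
      have := Finset.card_le_card hsub
      rwa [Finset.card_image_of_injective _ (fun a b h => by exact_mod_cast h), Finset.card_range] at this
    have h2 : q.roots.toFinset.card ≤ q.natDegree := (Multiset.toFinset_card_le _).trans (Polynomial.card_roots' q)
    omega
  have : q.eval (x 5) = 0 := by rw [hqz, Polynomial.eval_zero]
  rwa [hq, eval_pevalX] at this

/-- **Kernel polynomial identity test, sliced in `t`**: hypotheses `hv`, `hD`, `hvs`, `hs` are decided by the kernel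
(`hs` one Kronecker evaluation per slice `j = 0..D`, each of five-variable size). -/
theorem peval_eq_zero_of_kron6_slices {R : Type*} [CommRing R] (e : Expr) (hv : varsLT 6 e = true) (D : ℕ) (hD : degB 5 e ≤ D)
    (hvs : ∀ j : ℕ, j ≤ D → varsLT 6 (substs (σT j) e) = true)
    (hs : ∀ j : ℕ, j ≤ D → peval (substs (σT j) e) (kronPoint6 (substs (σT j) e)) = 0)
    (a₀ a₁ a₂ a₃ a₄ a₅ : R) : peval e [a₀, a₁, a₂, a₃, a₄, a₅] = 0 := by
  rw [peval_eq_eval₂_toMv6, toMv6_eq_zero_of_slices e hv D hD hvs hs, map_zero]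

/-! ### Smoke test -/

/-- `(v₀ + v₅)² − v₀² − 2v₀v₅ − v₅² = 0` by three slices `v₅ := 0, 1, 2`. -/
example (a t : ℚ) : (a + t) ^ 2 - a ^ 2 - 2 * a * t - t ^ 2 = 0 := by
  let e : Expr := .sub (.sub (.sub (.pow (.add (.var 0) (.var 5)) 2) (.pow (.var 0) 2))
    (.mul (.mul (.num 2) (.var 0)) (.var 5))) (.pow (.var 5) 2)
  have h := peval_eq_zero_of_kron6_slices e (by decide +kernel) 2 (by decide +kernel)
    (by intro j hj; interval_cases j <;> decide +kernel) (by intro j hj; interval_cases j <;> decide +kernel) a 0 0 0 0 t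
  have d0 : pvar [a, (0:ℚ), 0, 0, 0, t] 0 = a := rfl
  have d5 : pvar [a, (0:ℚ), 0, 0, 0, t] 5 = t := rfl
  simp only [e, peval_sub, peval_pow, peval_add, peval_mul, peval_num, peval_var, d0, d5] at h
  push_cast at h
  linear_combination h

end PolyReflect

end Summit.KontsevichZagierPeriods.Zeta5Search.Certificates
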